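import Summits.QuantumFields.GaugeBoot.DiagonalRPTorusReplicaTransport
import Summits.QuantumFields.GaugeBoot.TreeGaugeFactorization
import HarnessLib

/-!
# The doubled forest principle: replica cluster integrals vanish under a forest split
(gauge-boot, L3 `d = 3` uniform window, brick 6d)

HONEST FRAMING (cell `pub-gaugeboot`, page 1 of every file): the venture produces certified bounds
on lattice expectations at stated coupling, gauge group, dimension and torus size; NOT a mass gap,
NOT a continuum limit, NOT a string tension; NOT Yang–Mills-summit-bearing (barriers
`FixedCouplingUltralocality`, `PerturbativeInvisibility`). This module is the structural vanishing
lemma for the combinatorial crux of the `d = 3` leg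
(`HOME/pub-gaugeboot-lean3/gen46/D3-UNIFORM-PLAN.md` §3); it evaluates no cluster and proves no
window.

## Content (torus `(ℤ/L)^d`, compact metrisable `G`, continuous `ρ`, complex coupling `z`)

The replica cluster integral of `DiagonalRPTorusRestJetClusters`, on the doubled torus
(`DiagonalRPTorusReplicaTransport.replicaTerm_eq_integral_prod`):
`replicaTerm Q z = ∫∫ (f V - f V')(g V - g V') ∏_{q ∈ Q} w_q(V, V') dπ(V) dπ(V')`.

* `sideFactor f Q₁ z (V, V') = (f V - f V') ∏_{q ∈ Q₁} w_q(V, V')` — for a split `Q = Q₁ ⊔ Q₂`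
  the integrand is `sideFactor f Q₁ · sideFactor g Q₂` (`replicaIntegrand_eq_mul`); each side
  factor is ANTISYMMETRIC under the exchange of the replicas (`sideFactor_swap`), gauge invariant
  in each replica when `f` is (`sideFactor_gaugeTransform_fst/snd`: the plaquette weights are
  gauge invariant), and reads, in each replica, only the links `E₁ ∪ links(Q₁)`.
* ★★ **`replicaTerm_eq_zero_of_forestSplit`** — THE DOUBLED FOREST PRINCIPLE: if `f` is a bounded
  measurable GAUGE-INVARIANT observable reading `E₁`, `g` bounded measurable reading `E₂`,
  `Q = Q₁ ⊔ Q₂`, and the INTERFACE `(E₁ ∪ links Q₁) ∩ (E₂ ∪ links Q₂)` is gauge-fixable (a forest,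
  `TreeGauge.GaugeFixable`), then `replicaTerm f g Q z = 0` for EVERY `z`. Proof: Fubini on
  `π ⊗ π`; for each fixed second replica the forest principle of `TreeGaugeFactorization` in the
  first replica factorises `∫ A B = (∫A)(∫B)`; the partial integrals are again gauge invariant /
  supported as before, so the forest principle in the second replica factorises once more; and
  `∫∫ A = 0` by antisymmetry. Corollaries `replicaTerm_eq_zero_of_uncovered_left/right` (one side
  empty: a cluster that, together with one observable, meets the other observable's links only
  along a forest — e.g. fails to cover a link of its loop — contributes NOTHING, at any order).

Consequence for the crux (plan note §3 item 6c): in the sum over joining rest-plaquette sets of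
size `≤ 10` around the two bent hexagons, every set admitting such a split drops out IDENTICALLY
(not only to leading order); what remains to classify are the sets with no forest split (the
annuli), a statement about SETS of plaquettes and loops, free of Haar integrals.
Elementary given bricks 1 and 6c; no named fact.
-/

open MeasureTheory Finset Function

namespace Summit.QuantumFields.GaugeBoot

open Literature.MathematicalPhysics.QuantumFieldTheory

noncomputable section

namespace DiagRPUnif

open DiagRPTube

variable {d L : ℕ} [NeZero L] {N : ℕ} {G : Type*} [Group G] [TopologicalSpace G]
  [IsTopologicalGroup G] [CompactSpace G] [MeasurableSpace G] [BorelSpace G]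
  [SecondCountableTopology G] (ρ : G →* Matrix (Fin N) (Fin N) ℂ)

/-! ## Side factors -/

/-- The SIDE FACTOR of an observable `f` with the plaquettes `Q₁`:
`(f V - f V') ∏_{q ∈ Q₁} w_q(V, V')`. -/
def sideFactor (f : GaugeConfig d L G → ℝ) (Q₁ : Finset (Plaquette d L)) (z : ℂ)
    (p : GaugeConfig d L G × GaugeConfig d L G) : ℂ :=
  (((f p.1 : ℝ) : ℂ) - f p.2) * ∏ q ∈ Q₁, tdweight ρ z q p

omit [NeZero L] [TopologicalSpace G] [IsTopologicalGroup G] [CompactSpace G] [MeasurableSpace G]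
  [BorelSpace G] [SecondCountableTopology G] in
/-- **Splitting of the replica integrand**: for `Q = Q₁ ⊔ Q₂`,
`replicaIntegrand f g Q = sideFactor f Q₁ · sideFactor g Q₂`. -/
theorem replicaIntegrand_eq_mul {f g : GaugeConfig d L G → ℝ} {Q Q₁ Q₂ : Finset (Plaquette d L)}
    (hQ : Q = Q₁ ∪ Q₂) (hdisj : Disjoint Q₁ Q₂) (z : ℂ)
    (p : GaugeConfig d L G × GaugeConfig d L G) :
    replicaIntegrand ρ f g Q z p = sideFactor ρ f Q₁ z p * sideFactor ρ g Q₂ z p := by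
  simp only [replicaIntegrand, sideFactor, hQ, prod_union hdisj]
  ring

omit [NeZero L] [TopologicalSpace G] [IsTopologicalGroup G] [CompactSpace G] [MeasurableSpace G]
  [BorelSpace G] [SecondCountableTopology G] in
/-- **Antisymmetry** of a side factor under the exchange of the replicas. -/
theorem sideFactor_swap (f : GaugeConfig d L G → ℝ) (Q₁ : Finset (Plaquette d L)) (z : ℂ)
    (V V' : GaugeConfig d L G) :
    sideFactor ρ f Q₁ z (V', V) = -sideFactor ρ f Q₁ z (V, V') := by
  simp only [sideFactor, tdweight_swap]
  ring

omit [NeZero L] [TopologicalSpace G] [IsTopologicalGroup G] [CompactSpace G] [MeasurableSpace G]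
  [BorelSpace G] [SecondCountableTopology G] in
/-- Gauge invariance of a side factor in the FIRST replica (`f` gauge invariant). -/
theorem sideFactor_gaugeTransform_fst {f : GaugeConfig d L G → ℝ} (hf : IsGaugeInvariant f)
    (Q₁ : Finset (Plaquette d L)) (z : ℂ) (γ : Site d L → G) (V V' : GaugeConfig d L G) :
    sideFactor ρ f Q₁ z (gaugeTransform γ V, V') = sideFactor ρ f Q₁ z (V, V') := by
  simp only [sideFactor, tdweight, hf γ V, tweight_gaugeTransform]

omit [NeZero L] [TopologicalSpace G] [IsTopologicalGroup G] [CompactSpace G] [MeasurableSpace G]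
  [BorelSpace G] [SecondCountableTopology G] in
/-- Gauge invariance of a side factor in the SECOND replica (`f` gauge invariant). -/
theorem sideFactor_gaugeTransform_snd {f : GaugeConfig d L G → ℝ} (hf : IsGaugeInvariant f)
    (Q₁ : Finset (Plaquette d L)) (z : ℂ) (γ : Site d L → G) (V V' : GaugeConfig d L G) :
    sideFactor ρ f Q₁ z (V, gaugeTransform γ V') = sideFactor ρ f Q₁ z (V, V') := by
  simp only [sideFactor, tdweight, hf γ V', tweight_gaugeTransform]

omit [NeZero L] [TopologicalSpace G] [IsTopologicalGroup G] [CompactSpace G] [MeasurableSpace G]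
  [BorelSpace G] [SecondCountableTopology G] in
/-- The product of doubled weights over `Q₁` reads, in each replica, only the links of `Q₁`. -/
theorem prod_tdweight_congr {Q₁ : Finset (Plaquette d L)} (z : ℂ) {V W V' W' : GaugeConfig d L G}
    (h : ∀ e ∈ linksOf Q₁, V e = W e) (h' : ∀ e ∈ linksOf Q₁, V' e = W' e) :
    ∏ q ∈ Q₁, tdweight ρ z q (V, V') = ∏ q ∈ Q₁, tdweight ρ z q (W, W') := by
  refine prod_congr rfl fun q hq => ?_
  have hq' : ∀ e ∈ (plinks q : Set (Edge d L)), e ∈ linksOf Q₁ := fun e he =>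
    plinks_subset_linksOf hq (mem_coe.1 he)
  simp only [tdweight]
  rw [dependsOn_tweight ρ z q (fun e he => h e (hq' e he)),
    dependsOn_tweight ρ z q (fun e he => h' e (hq' e he))]

omit [NeZero L] [TopologicalSpace G] [IsTopologicalGroup G] [CompactSpace G] [MeasurableSpace G]
  [BorelSpace G] [SecondCountableTopology G] in
/-- A side factor reads, in the FIRST replica, only `E₁ ∪ links(Q₁)`. -/
theorem dependsOn_sideFactor_fst {f : GaugeConfig d L G → ℝ} {E₁ : Finset (Edge d L)}
    (hfE : DependsOn f (E₁ : Set (Edge d L))) (Q₁ : Finset (Plaquette d L)) (z : ℂ)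
    (V' : GaugeConfig d L G) :
    DependsOn (fun V => sideFactor ρ f Q₁ z (V, V'))
      ((E₁ ∪ linksOf Q₁ : Finset (Edge d L)) : Set (Edge d L)) := by
  intro V W h
  simp only [sideFactor]
  rw [hfE (fun e he => h e (by rw [coe_union]; exact Or.inl he)),
    prod_tdweight_congr ρ z (fun e he => h e (by rw [coe_union]; exact Or.inr he)) (fun _ _ => rfl)]

omit [NeZero L] [TopologicalSpace G] [IsTopologicalGroup G] [CompactSpace G] [MeasurableSpace G]
  [BorelSpace G] [SecondCountableTopology G] in
/-- A side factor reads, in the SECOND replica, only `E₁ ∪ links(Q₁)`. -/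
theorem dependsOn_sideFactor_snd {f : GaugeConfig d L G → ℝ} {E₁ : Finset (Edge d L)}
    (hfE : DependsOn f (E₁ : Set (Edge d L))) (Q₁ : Finset (Plaquette d L)) (z : ℂ)
    (V : GaugeConfig d L G) :
    DependsOn (fun V' => sideFactor ρ f Q₁ z (V, V'))
      ((E₁ ∪ linksOf Q₁ : Finset (Edge d L)) : Set (Edge d L)) := by
  intro V' W' h
  simp only [sideFactor]
  rw [hfE (fun e he => h e (by rw [coe_union]; exact Or.inl he)),
    prod_tdweight_congr ρ z (fun _ _ => rfl) (fun e he => h e (by rw [coe_union]; exact Or.inr he))]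

omit [CompactSpace G] in
/-- Side factors are measurable. -/
theorem measurable_sideFactor (hρ : Continuous ρ) {f : GaugeConfig d L G → ℝ} (hfm : Measurable f)
    (Q₁ : Finset (Plaquette d L)) (z : ℂ) : Measurable (sideFactor ρ f Q₁ z) := by
  unfold sideFactor
  exact ((Complex.measurable_ofReal.comp (hfm.comp measurable_fst)).sub
    (Complex.measurable_ofReal.comp (hfm.comp measurable_snd))).mul
    (Finset.measurable_prod _ fun q _ => measurable_tdweight ρ hρ z q)

omit [NeZero L] [MeasurableSpace G] [BorelSpace G] [SecondCountableTopology G] in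
/-- `‖w_q(V,V')‖ ≤ (e^{2N‖z‖} + 2)² + 1`. -/
theorem norm_tdweight_le (hρ : Continuous ρ) (z : ℂ) (q : Plaquette d L)
    (p : GaugeConfig d L G × GaugeConfig d L G) :
    ‖tdweight ρ z q p‖ ≤ (Real.exp (2 * N * ‖z‖) + 2) ^ 2 + 1 := by
  unfold tdweight
  have h1 : ∀ V : GaugeConfig d L G, ‖1 + tweight ρ z q V‖ ≤ Real.exp (2 * N * ‖z‖) + 2 := fun V =>
    (norm_add_le _ _).trans (by rw [norm_one]; linarith [norm_tweight_le ρ hρ z q V])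
  refine (norm_sub_le _ _).trans (add_le_add ?_ (by simp))
  rw [norm_mul, pow_two]
  exact mul_le_mul (h1 _) (h1 _) (norm_nonneg _) (by positivity)

omit [NeZero L] [MeasurableSpace G] [BorelSpace G] [SecondCountableTopology G] in
/-- Side factors are bounded: `‖sideFactor f Q₁ z‖ ≤ 2C ((e^{2N‖z‖}+2)² + 1)^{#Q₁}`. -/
theorem norm_sideFactor_le (hρ : Continuous ρ) {f : GaugeConfig d L G → ℝ} {C : ℝ}
    (hfb : ∀ U, |f U| ≤ C) (Q₁ : Finset (Plaquette d L)) (z : ℂ)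
    (p : GaugeConfig d L G × GaugeConfig d L G) :
    ‖sideFactor ρ f Q₁ z p‖ ≤ 2 * C * ((Real.exp (2 * N * ‖z‖) + 2) ^ 2 + 1) ^ Q₁.card := by
  unfold sideFactor
  rw [norm_mul]
  have hC : 0 ≤ C := (abs_nonneg _).trans (hfb p.1)
  have h1 : ‖((f p.1 : ℝ) : ℂ) - f p.2‖ ≤ 2 * C := by
    refine (norm_sub_le _ _).trans ?_
    rw [Complex.norm_real, Complex.norm_real, Real.norm_eq_abs, Real.norm_eq_abs]
    linarith [hfb p.1, hfb p.2]
  have h2 : ‖∏ q ∈ Q₁, tdweight ρ z q p‖ ≤ ((Real.exp (2 * N * ‖z‖) + 2) ^ 2 + 1) ^ Q₁.card := by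
    refine (Finset.norm_prod_le _ _).trans ?_
    rw [← prod_const]
    exact prod_le_prod (fun _ _ => norm_nonneg _) fun q _ => norm_tdweight_le ρ hρ z q p
  exact mul_le_mul h1 h2 (norm_nonneg _) (by linarith)

/-! ## The doubled forest principle -/

omit [SecondCountableTopology G] in
/-- **Antisymmetric functions integrate to zero on `π ⊗ π`.** -/
theorem integral_prod_eq_zero_of_swap {A : GaugeConfig d L G × GaugeConfig d L G → ℂ}
    (hA : ∀ V V', A (V', V) = -A (V, V')) :
    ∫ p, A p ∂(Measure.pi fun _ : Edge d L => haarProbability G).prod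
      (Measure.pi fun _ : Edge d L => haarProbability G) = 0 := by
  have h := integral_prod_swap (μ := Measure.pi fun _ : Edge d L => haarProbability G)
    (ν := Measure.pi fun _ : Edge d L => haarProbability G) A
  have hswap : (fun p : GaugeConfig d L G × GaugeConfig d L G => A p.swap) = fun p => -A p := by
    funext p; exact hA p.1 p.2
  rw [hswap, integral_neg] at h
  have : (2 : ℂ) * ∫ p, A p ∂(Measure.pi fun _ : Edge d L => haarProbability G).prod
      (Measure.pi fun _ : Edge d L => haarProbability G) = 0 := by
    rw [two_mul]; nth_rewrite 1 [← h]; ring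
  exact (mul_eq_zero.1 this).resolve_left two_ne_zero

/-- ★★ **THE DOUBLED FOREST PRINCIPLE (integral form).** Let `f` be bounded measurable and gauge
invariant, reading `E₁`; `g` bounded measurable reading `E₂`; `Q₁`, `Q₂` sets of plaquettes with
the interface `(E₁ ∪ links Q₁) ∩ (E₂ ∪ links Q₂)` gauge-fixable. Then
`∫∫ sideFactor f Q₁ · sideFactor g Q₂ d(π ⊗ π) = 0`. -/
theorem integral_sideFactor_mul_eq_zero (hρ : Continuous ρ) {f g : GaugeConfig d L G → ℝ}
    (hfm : Measurable f) (hgm : Measurable g) {Cf Cg : ℝ} (hfb : ∀ U, |f U| ≤ Cf)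
    (hgb : ∀ U, |g U| ≤ Cg) (hfinv : IsGaugeInvariant f) {E₁ E₂ : Finset (Edge d L)}
    (hfE : DependsOn f (E₁ : Set (Edge d L))) (hgE : DependsOn g (E₂ : Set (Edge d L)))
    {Q₁ Q₂ : Finset (Plaquette d L)}
    (hF : TreeGauge.GaugeFixable G ((E₁ ∪ linksOf Q₁) ∩ (E₂ ∪ linksOf Q₂))) (z : ℂ) :
    ∫ p, sideFactor ρ f Q₁ z p * sideFactor ρ g Q₂ z p
      ∂(Measure.pi fun _ : Edge d L => haarProbability G).prod
        (Measure.pi fun _ : Edge d L => haarProbability G) = 0 := by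
  set π : Measure (GaugeConfig d L G) := Measure.pi fun _ : Edge d L => haarProbability G with hπ
  set A := sideFactor ρ f Q₁ z with hA
  set B := sideFactor ρ g Q₂ z with hB
  set KA : ℝ := 2 * Cf * ((Real.exp (2 * N * ‖z‖) + 2) ^ 2 + 1) ^ Q₁.card with hKA
  set KB : ℝ := 2 * Cg * ((Real.exp (2 * N * ‖z‖) + 2) ^ 2 + 1) ^ Q₂.card with hKB
  have hAm : Measurable A := measurable_sideFactor ρ hρ hfm Q₁ z
  have hBm : Measurable B := measurable_sideFactor ρ hρ hgm Q₂ z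
  have hAb : ∀ p, ‖A p‖ ≤ KA := norm_sideFactor_le ρ hρ hfb Q₁ z
  have hBb : ∀ p, ‖B p‖ ≤ KB := norm_sideFactor_le ρ hρ hgb Q₂ z
  have hKA0 : 0 ≤ KA := (norm_nonneg _).trans (hAb (1, 1))
  -- Fubini
  have hint : Integrable (fun p => A p * B p) (π.prod π) := by
    refine Integrable.of_bound (hAm.mul hBm).aestronglyMeasurable (KA * KB)
      (ae_of_all _ fun p => ?_)
    rw [norm_mul]; exact mul_le_mul (hAb p) (hBb p) (norm_nonneg _) hKA0
  rw [integral_prod _ hint]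
  -- inner integral: the forest principle in the SECOND replica, for each fixed first replica
  have hinner : ∀ V : GaugeConfig d L G, ∫ V', A (V, V') * B (V, V') ∂π =
      (∫ V', A (V, V') ∂π) * ∫ V', B (V, V') ∂π := by
    intro V
    exact TreeGauge.integral_mul_eq_of_gaugeFixable_inter hF
      (hAm.comp (measurable_const.prodMk measurable_id))
      (hBm.comp (measurable_const.prodMk measurable_id)) (fun V' => hAb (V, V'))
      (fun V' => hBb (V, V')) (fun γ V' => sideFactor_gaugeTransform_snd ρ hfinv Q₁ z γ V V')
      (dependsOn_sideFactor_snd ρ hfE Q₁ z V) (dependsOn_sideFactor_snd ρ hgE Q₂ z V)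
  simp_rw [hinner]
  -- the partial integrals
  set a : GaugeConfig d L G → ℂ := fun V => ∫ V', A (V, V') ∂π with ha
  set b : GaugeConfig d L G → ℂ := fun V => ∫ V', B (V, V') ∂π with hb
  have ham : Measurable a :=
    (hAm.stronglyMeasurable.integral_prod_right' (ν := π)).measurable
  have hbm : Measurable b :=
    (hBm.stronglyMeasurable.integral_prod_right' (ν := π)).measurable
  have hab : ∀ V, ‖a V‖ ≤ KA := fun V => by
    refine (norm_integral_le_of_norm_le_const (ae_of_all _ fun V' => hAb (V, V'))).trans ?_
    rw [probReal_univ, mul_one]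
  have hbb : ∀ V, ‖b V‖ ≤ KB := fun V => by
    refine (norm_integral_le_of_norm_le_const (ae_of_all _ fun V' => hBb (V, V'))).trans ?_
    rw [probReal_univ, mul_one]
  have hainv : IsGaugeInvariant a := fun γ V => by
    simp only [ha, hA, sideFactor_gaugeTransform_fst ρ hfinv]
  have hadep : DependsOn a ((E₁ ∪ linksOf Q₁ : Finset (Edge d L)) : Set (Edge d L)) := by
    intro V W h
    simp only [ha]
    exact integral_congr_ae (ae_of_all _ fun V' => dependsOn_sideFactor_fst ρ hfE Q₁ z V' h)
  have hbdep : DependsOn b ((E₂ ∪ linksOf Q₂ : Finset (Edge d L)) : Set (Edge d L)) := by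
    intro V W h
    simp only [hb]
    exact integral_congr_ae (ae_of_all _ fun V' => dependsOn_sideFactor_fst ρ hgE Q₂ z V' h)
  -- outer integral: the forest principle in the FIRST replica
  have houter : ∫ V, a V * b V ∂π = (∫ V, a V ∂π) * ∫ V, b V ∂π :=
    TreeGauge.integral_mul_eq_of_gaugeFixable_inter hF ham hbm hab hbb hainv hadep hbdep
  change ∫ V, a V * b V ∂π = 0
  rw [houter]
  -- `∫ a = ∫∫ A = 0` by antisymmetry
  have hintA : Integrable A (π.prod π) :=
    Integrable.of_bound hAm.aestronglyMeasurable KA (ae_of_all _ hAb)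
  have hzero : ∫ V, a V ∂π = 0 := by
    rw [ha, ← integral_prod _ hintA]
    exact integral_prod_eq_zero_of_swap (sideFactor_swap ρ f Q₁ z)
  rw [hzero, zero_mul]

/-- ★★ **THE DOUBLED FOREST PRINCIPLE.** For a split `Q = Q₁ ⊔ Q₂` of a set of plaquettes whose
INTERFACE `(E₁ ∪ links Q₁) ∩ (E₂ ∪ links Q₂)` is gauge-fixable (a forest), with `f` bounded
measurable gauge invariant reading `E₁` and `g` bounded measurable reading `E₂`, the replica
cluster integral VANISHES IDENTICALLY: `replicaTerm f g Q z = 0` for every complex `z`. -/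
theorem replicaTerm_eq_zero_of_forestSplit (hρ : Continuous ρ) {f g : GaugeConfig d L G → ℝ}
    (hfm : Measurable f) (hgm : Measurable g) {Cf Cg : ℝ} (hfb : ∀ U, |f U| ≤ Cf)
    (hgb : ∀ U, |g U| ≤ Cg) (hfinv : IsGaugeInvariant f) {E₁ E₂ : Finset (Edge d L)}
    (hfE : DependsOn f (E₁ : Set (Edge d L))) (hgE : DependsOn g (E₂ : Set (Edge d L)))
    {Q Q₁ Q₂ : Finset (Plaquette d L)} (hQ : Q = Q₁ ∪ Q₂) (hdisj : Disjoint Q₁ Q₂)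
    (hF : TreeGauge.GaugeFixable G ((E₁ ∪ linksOf Q₁) ∩ (E₂ ∪ linksOf Q₂))) (z : ℂ) :
    replicaTerm ρ f g Q z = 0 := by
  rw [replicaTerm_eq_integral_prod ρ hρ hfm hgm Q z]
  simp_rw [replicaIntegrand_eq_mul ρ hQ hdisj z]
  exact integral_sideFactor_mul_eq_zero ρ hρ hfm hgm hfb hgb hfinv hfE hgE hF z

omit [SecondCountableTopology G] in
/-- The replica cluster integral is symmetric in the two observables. -/
theorem replicaTerm_comm (f g : GaugeConfig d L G → ℝ) (Q : Finset (Plaquette d L)) (z : ℂ) :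
    replicaTerm ρ f g Q z = replicaTerm ρ g f Q z := by
  unfold replicaTerm
  exact integral_congr_ae (ae_of_all _ fun W => by ring)

/-- **Uncovered on the right**: if `f` (gauge invariant) together with the WHOLE cluster meets the
links read by `g` only along a gauge-fixable set, the replica cluster integral vanishes. -/
theorem replicaTerm_eq_zero_of_uncovered_right (hρ : Continuous ρ) {f g : GaugeConfig d L G → ℝ}
    (hfm : Measurable f) (hgm : Measurable g) {Cf Cg : ℝ} (hfb : ∀ U, |f U| ≤ Cf)
    (hgb : ∀ U, |g U| ≤ Cg) (hfinv : IsGaugeInvariant f) {E₁ E₂ : Finset (Edge d L)}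
    (hfE : DependsOn f (E₁ : Set (Edge d L))) (hgE : DependsOn g (E₂ : Set (Edge d L)))
    (Q : Finset (Plaquette d L)) (hF : TreeGauge.GaugeFixable G ((E₁ ∪ linksOf Q) ∩ E₂)) (z : ℂ) :
    replicaTerm ρ f g Q z = 0 := by
  refine replicaTerm_eq_zero_of_forestSplit ρ hρ hfm hgm hfb hgb hfinv hfE hgE (Q₁ := Q) (Q₂ := ∅)
    (by simp) (disjoint_empty_right _) ?_ z
  simpa [linksOf] using hF

/-- **Uncovered on the left**: if `g` (gauge invariant) together with the whole cluster meets the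
links read by `f` only along a gauge-fixable set, the replica cluster integral vanishes. -/
theorem replicaTerm_eq_zero_of_uncovered_left (hρ : Continuous ρ) {f g : GaugeConfig d L G → ℝ}
    (hfm : Measurable f) (hgm : Measurable g) {Cf Cg : ℝ} (hfb : ∀ U, |f U| ≤ Cf)
    (hgb : ∀ U, |g U| ≤ Cg) (hginv : IsGaugeInvariant g) {E₁ E₂ : Finset (Edge d L)}
    (hfE : DependsOn f (E₁ : Set (Edge d L))) (hgE : DependsOn g (E₂ : Set (Edge d L)))
    (Q : Finset (Plaquette d L)) (hF : TreeGauge.GaugeFixable G ((E₂ ∪ linksOf Q) ∩ E₁)) (z : ℂ) :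
    replicaTerm ρ f g Q z = 0 := by
  rw [replicaTerm_comm]
  exact replicaTerm_eq_zero_of_uncovered_right ρ hρ hgm hfm hgb hfb hginv hgE hfE Q hF z

end DiagRPUnif

end

end Summit.QuantumFields.GaugeBoot
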